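import Literature.Barriers.HodgeConjecture.GeneralizedHodgeTrivialReasonsEllipticCurveCubedRational
import Literature.NumberTheory.EllipticCurves.UniformizationHolomorphic
import Literature.AlgebraicGeometry.HodgeTheory.ComplexifiedDeRhamFamily
import Literature.AlgebraicGeometry.Motives.SegreEmbedding
import Literature.NumberTheory.Transcendental.AnalytificationSeparatedProofs
import Literature.Geometry.Kaehler.ComplexTorusCover
import Mathlib.Topology.Homeomorph.Lemmas
import HarnessLib

/-!
# `E_τ³` is an algebraic model of the complex torus `ℂ³/(ℤ + τℤ)³`

Companion to `GeneralizedHodgeTrivialReasonsEllipticCurveCubedRational.lean`, which reduced the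
named fact `Grothendieck1969_ellipticCurveCubed_hodgeDecomposition` (`…FiltOne.lean`: the Hodge
structure of `H³(E_τ³)` in the Künneth basis, Lange–Birkenhake 1992, §1.1.3–§1.1.5) to two inputs
(`…_of_models`): (a) de Rham's theorem with complex coefficients on manifolds charted on `ℂ³`
(the named fact `exists_complexDeRhamIsoFamily (Fin 3 → ℂ)`), and (b) for every `τ`, `Im τ > 0`, a
smooth projective complex threefold whose analytification is the torus
`T_τ = EllipticCurveCubedTorus τ _ = ℂ³/(ℤ + τℤ)³`. THIS FILE PROVES (b):

* `cubeScheme τ hτ = E × E × E` with `E = E_Λ` the Weierstrass cubic of the lattice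
  `Λ = ℤ + τℤ` as a smooth projective `ℂ`-scheme (the tree's `WeierstrassCurve.scheme`,
  `isSmoothProjective_scheme`; products by the tree's Segre embedding
  `IsSmoothProjective.tensor_holds`): `isSmoothProjective_cubeScheme`;
* `cubeMap τ hτ : ℂ³ → (E × E × E)(ℂ)`, `u ↦ (φ(u₀), φ(u₁), φ(u₂))`, `φ(z) = [℘(z), ℘'(z)/2, 1]`
  (`PeriodPair.upoint`, `Motives/AlgPoints.prodEquiv`): `Λ³`-periodic, injective modulo `Λ³`,
  onto, continuous, and a HOLOMORPHIC FAMILY near every point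
  (`EllipticCurves/UniformizationHolomorphic`, `Motives/AlgPointsHolomorphicFamilies`), so that
  regular functions pull back to holomorphic functions on `ℂ³`
  (`differentiableOn_evalOrZero_cubeMap`);
* `torusMap τ hτ : T_τ → (E × E × E)(ℂ)`, the descent of `cubeMap` to the torus
  (`torusMap_cover`), is a homeomorphism (continuous bijection, compact onto Hausdorff) and an
  ANALYTIFICATION: `isAnalytification_torusMap : IsAnalytification (Fin 3 → ℂ) (cubeScheme τ hτ) 3 (torusMap τ hτ)`
  — Silverman, *AEC* VI Prop. 3.6 (b) (`ℂ/Λ ≅ E_Λ(ℂ)` complex analytically) with Serre, GAGA §2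
  (`(X × Y)^h = X^h × Y^h`), for the cube;
* `exists_algebraicModel_ellipticCurveCubedTorus` — hypothesis (b) of `…_of_models`, verbatim;
* **`Grothendieck1969_ellipticCurveCubed_hodgeDecomposition_of_deRham`** — the named fact follows
  from de Rham's theorem `exists_complexDeRhamIsoFamily (Fin 3 → ℂ)` ALONE.

Everything here is proved; no named facts are introduced.

## References

* [LangeBirkenhake1992] H. Lange, Ch. Birkenhake, *Complex Abelian Varieties* (1992), §1.1.
* [SilvermanAEC2009] J. H. Silverman, *The Arithmetic of Elliptic Curves* (2009), VI Prop. 3.6 (b).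
* [SerreGAGA1956] J.-P. Serre, GAGA (1956), §2 n°5.
* [GrothendieckTopology1969] A. Grothendieck, Topology 8 (1969), p. 300.
-/

noncomputable section

open CategoryTheory MonoidalCategory AlgebraicGeometry Complex Metric Set Filter
open scoped Manifold ContDiff Topology
open Literature.AlgebraicGeometry.Motives Literature.AlgebraicGeometry.Motives.AlgPoints
open Literature.AlgebraicGeometry.HodgeTheory Literature.NumberTheory.Transcendental
open Literature.Geometry.Kaehler

namespace Literature.Barriers.HodgeConjecture

/-! ### The lattice `ℤ + τℤ` as a period pair, and the cube `E × E × E` -/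

section Cube

variable (τ : ℂ)

/-- `1, τ` are `ℝ`-linearly independent for `Im τ ≠ 0`. [folklore] -/
theorem linearIndependent_one_tau (hτ : τ.im ≠ 0) : LinearIndependent ℝ ![(1 : ℂ), τ] := by
  refine LinearIndependent.pair_iff.mpr fun s t hst ↦ ?_
  rw [Complex.real_smul, Complex.real_smul, mul_one] at hst
  have him : t * τ.im = 0 := by simpa using congrArg Complex.im hst
  have ht : t = 0 := (mul_eq_zero.mp him).resolve_right hτ
  have hre : s = 0 := by simpa [ht] using congrArg Complex.re hst
  exact ⟨hre, ht⟩

variable (hτ : τ.im ≠ 0)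

/-- **The period pair `(1, τ)`** of the lattice `Λ_τ = ℤ + τℤ`, `Im τ ≠ 0` (Mathlib `PeriodPair`).
[cite: SilvermanAEC2009, VI §3] -/
def cubePeriodPair : PeriodPair := ⟨1, τ, linearIndependent_one_tau τ hτ⟩

/-- `ω₁ = 1`. [folklore] -/
@[simp] theorem cubePeriodPair_ω₁ : (cubePeriodPair τ hτ).ω₁ = 1 := rfl

/-- `ω₂ = τ`. [folklore] -/
@[simp] theorem cubePeriodPair_ω₂ : (cubePeriodPair τ hτ).ω₂ = τ := rfl

/-- Membership in `Λ_τ`: `x ∈ ℤ + τℤ ↔ x = m + nτ`. [folklore] -/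
theorem mem_lattice_cubePeriodPair_iff (x : ℂ) :
    x ∈ (cubePeriodPair τ hτ).lattice ↔ ∃ m n : ℤ, (m : ℂ) + n * τ = x := by
  rw [PeriodPair.mem_lattice, cubePeriodPair_ω₁, cubePeriodPair_ω₂]
  simp only [mul_one]

/-- **The elliptic curve `E = E_{Λ_τ}`** as a smooth projective `ℂ`-scheme: the Weierstrass plane
cubic `y² = x³ − (g₂/4)x − g₃/4` of the lattice `ℤ + τℤ` (the tree's `PeriodPair.curve` and
`WeierstrassCurve.scheme`). [cite: SilvermanAEC2009, VI Prop. 3.6] -/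
def cubeCurve : SchemeOver ℂ := (cubePeriodPair τ hτ).curve.scheme

/-- **The cube `E × E × E`** over `ℂ` (fibre product, the cartesian monoidal structure of
`SchemeOver ℂ`). In print `E_τ³`, Grothendieck (1969), p. 300. [cite: GrothendieckTopology1969, p. 300] -/
def cubeScheme : SchemeOver ℂ := cubeCurve τ hτ ⊗ (cubeCurve τ hτ ⊗ cubeCurve τ hτ)

/-- **`E × E × E` is a smooth projective complex threefold** (each factor a smooth projective
curve, Silverman III.3.1 (c) via the tree's `isSmoothProjective_scheme`; products by the Segre
embedding, the tree's `IsSmoothProjective.tensor_holds`). [cite: SilvermanAEC2009, III.3.1(c)] -/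
theorem isSmoothProjective_cubeScheme : IsSmoothProjective 3 (cubeScheme τ hτ) := by
  have h1 : IsSmoothProjective 1 (cubeCurve τ hτ) :=
    (cubePeriodPair τ hτ).curve.isSmoothProjective_scheme
  exact IsSmoothProjective.tensor_holds h1 (IsSmoothProjective.tensor_holds h1 h1)

/-! ### The uniformisation of the cube, `ℂ³ → (E × E × E)(ℂ)` -/

/-- **The uniformisation of the cube**: `u ↦ (φ(u₀), φ(u₁), φ(u₂)) ∈ (E × E × E)(ℂ)` with
`φ = upoint : ℂ → E(ℂ)`, `z ↦ [℘(z), ℘'(z)/2, 1]` (pairs of points via `AlgPoints.prodEquiv`).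
[cite: SilvermanAEC2009, VI Prop. 3.6 (b)] -/
def cubeMap (u : Fin 3 → ℂ) : ComplexPoints (cubeScheme τ hτ) :=
  prodEquiv.symm ((cubePeriodPair τ hτ).upoint (u 0),
    prodEquiv.symm ((cubePeriodPair τ hτ).upoint (u 1), (cubePeriodPair τ hτ).upoint (u 2)))

/-- **`cubeMap u = cubeMap u'` iff `u ≡ u'` modulo `Λ_τ³`.** [cite: SilvermanAEC2009, VI Prop. 3.6 (b)] -/
theorem cubeMap_eq_cubeMap_iff {u u' : Fin 3 → ℂ} :
    cubeMap τ hτ u = cubeMap τ hτ u' ↔ ∀ a, u a - u' a ∈ (cubePeriodPair τ hτ).lattice := by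
  constructor
  · intro h a
    obtain ⟨h0, h12⟩ := Prod.ext_iff.mp (prodEquiv.symm.injective h)
    obtain ⟨h1, h2⟩ := Prod.ext_iff.mp (prodEquiv.symm.injective h12)
    fin_cases a
    · exact PeriodPair.upoint_eq_upoint_iff.mp h0
    · exact PeriodPair.upoint_eq_upoint_iff.mp h1
    · exact PeriodPair.upoint_eq_upoint_iff.mp h2
  · intro h
    exact congrArg prodEquiv.symm (Prod.ext (PeriodPair.upoint_eq_upoint_iff.mpr (h 0))
      (congrArg prodEquiv.symm (Prod.ext (PeriodPair.upoint_eq_upoint_iff.mpr (h 1))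
        (PeriodPair.upoint_eq_upoint_iff.mpr (h 2)))))

/-- **`cubeMap` is onto** (`upoint` is). [cite: SilvermanAEC2009, VI Prop. 3.6 (b)] -/
theorem cubeMap_surjective : Function.Surjective (cubeMap τ hτ) := by
  intro Q
  obtain ⟨u0, hu0⟩ := (cubePeriodPair τ hτ).upoint_surjective (prodEquiv Q).1
  obtain ⟨u1, hu1⟩ := (cubePeriodPair τ hτ).upoint_surjective (prodEquiv (prodEquiv Q).2).1
  obtain ⟨u2, hu2⟩ := (cubePeriodPair τ hτ).upoint_surjective (prodEquiv (prodEquiv Q).2).2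
  refine ⟨![u0, u1, u2], ?_⟩
  have e0 : (![u0, u1, u2] : Fin 3 → ℂ) 0 = u0 := rfl
  have e1 : (![u0, u1, u2] : Fin 3 → ℂ) 1 = u1 := rfl
  have e2 : (![u0, u1, u2] : Fin 3 → ℂ) 2 = u2 := rfl
  unfold cubeMap
  rw [e0, e1, e2, hu0, hu1, hu2, Prod.mk.eta, Equiv.symm_apply_apply, Prod.mk.eta,
    Equiv.symm_apply_apply]

/-- **`cubeMap` is continuous** (for the strong topology on `(E × E × E)(ℂ)`).
[cite: SilvermanAEC2009, VI Prop. 3.6 (b)] -/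
theorem continuous_cubeMap : Continuous (cubeMap τ hτ) :=
  continuous_prodEquiv_symm.comp
    ((((cubePeriodPair τ hτ).continuous_upoint).comp (continuous_apply 0)).prodMk
      (continuous_prodEquiv_symm.comp
        ((((cubePeriodPair τ hτ).continuous_upoint).comp (continuous_apply 1)).prodMk
          (((cubePeriodPair τ hτ).continuous_upoint).comp (continuous_apply 2)))))

/-- **`cubeMap` is a holomorphic family near every point of `ℂ³`** (products of the local
families of `upoint`, `AlgPoints.IsHolFamilyOn.prodMk`). [cite: SerreGAGA1956, §2 n°5] -/
theorem exists_isHolFamilyOn_cubeMap (u₀ : Fin 3 → ℂ) :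
    ∃ U : Set (Fin 3 → ℂ), IsOpen U ∧ u₀ ∈ U ∧ IsHolFamilyOn U (cubeMap τ hτ) := by
  choose ε hε hfam using fun a ↦ (cubePeriodPair τ hτ).exists_isHolFamilyOn_upoint (u₀ a)
  refine ⟨{u | ∀ a, u a ∈ ball (u₀ a) (ε a)}, ?_, fun a ↦ mem_ball_self (hε a), ?_⟩
  · rw [Set.setOf_forall]
    exact isOpen_iInter_of_finite fun a ↦ isOpen_ball.preimage (continuous_apply a)
  · have hd : ∀ a : Fin 3, DifferentiableOn ℂ (fun u : Fin 3 → ℂ ↦ u a)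
        {u : Fin 3 → ℂ | ∀ b, u b ∈ ball (u₀ b) (ε b)} := fun a u _ ↦
      (differentiableAt_apply (𝕜 := ℂ) a u).differentiableWithinAt
    have ha : ∀ a : Fin 3, IsHolFamilyOn {u : Fin 3 → ℂ | ∀ b, u b ∈ ball (u₀ b) (ε b)}
        ((cubePeriodPair τ hτ).upoint ∘ fun u : Fin 3 → ℂ ↦ u a) := fun a ↦
      IsHolFamilyOn.comp (P' := Fin 3 → ℂ) (hfam a) (fun u : Fin 3 → ℂ ↦ u a) (hd a)
        (fun u hu ↦ hu a)
    exact (ha 0).prodMk ((ha 1).prodMk (ha 2))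

/-- Preimages of opens `W(ℂ)` under `cubeMap` are open. [folklore] -/
theorem isOpen_preimage_cubeMap (W : (cubeScheme τ hτ).left.Opens) :
    IsOpen (cubeMap τ hτ ⁻¹' {Q | Q.pt ∈ W}) :=
  (isOpen_setOf_pt_mem W).preimage (continuous_cubeMap τ hτ)

/-- **Regular functions on `E × E × E` pull back to holomorphic functions on `ℂ³`**: for an open
`W` and `g ∈ Γ(E³, W)`, `u ↦ g(cubeMap u)` is complex differentiable on `cubeMap⁻¹(W(ℂ))`.
[cite: SerreGAGA1956, §2 n°5] -/
theorem differentiableOn_evalOrZero_cubeMap (W : (cubeScheme τ hτ).left.Opens)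
    (g : Γ((cubeScheme τ hτ).left, W)) :
    DifferentiableOn ℂ (fun u ↦ evalOrZero W g (cubeMap τ hτ u)) (cubeMap τ hτ ⁻¹' {Q | Q.pt ∈ W}) := by
  intro u₀ hu₀
  obtain ⟨U, hU, hu₀U, hfam⟩ := exists_isHolFamilyOn_cubeMap τ hτ u₀
  have hd := hfam.differentiableOn_evalOrZero hU W g
  have hopen := hfam.isOpen_inter_preimage hU W
  exact (hd.differentiableAt (hopen.mem_nhds ⟨hu₀U, hu₀⟩)).differentiableWithinAt

/-! ### Descent to the torus `T_τ = ℂ³/(ℤ + τℤ)³` -/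

/-- **The lattice of `T_τ` is `Λ_τ³`**: two points of `ℂ³` have the same image in
`T_τ = ComplexTorus (periodIso τ hτ)` iff they differ by an element of `(ℤ + τℤ)³`.
[cite: LangeBirkenhake1992, §1.1.1] -/
theorem cover_eq_cover_iff (z z' : Fin 3 → ℂ) :
    ComplexTorus.cover (periodIso τ hτ) z = ComplexTorus.cover (periodIso τ hτ) z' ↔
      ∀ a, z a - z' a ∈ (cubePeriodPair τ hτ).lattice := by
  have key : ∀ w : Fin 3 → ℂ, ComplexTorus.cover (periodIso τ hτ) w = ComplexTorus.cover (periodIso τ hτ) 0 ↔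
      ∀ a, w a ∈ (cubePeriodPair τ hτ).lattice := by
    intro w
    constructor
    · intro h
      have hp : ∀ p, ∃ n : ℤ, ((periodIso τ hτ).symm w p : ℝ) = n := by
        intro p
        have hp' := congrFun h p
        simp only [ComplexTorus.cover_apply, ComplexTorus.proj_apply, map_zero, Pi.zero_apply,
          QuotientAddGroup.mk_zero] at hp'
        obtain ⟨n, hn⟩ := (AddCircle.coe_eq_zero_iff (1 : ℝ)).mp hp'
        exact ⟨n, by rw [← hn, zsmul_eq_mul, mul_one]⟩
      choose N hN using hp
      have hw : w = periodIso τ hτ (fun p ↦ (N p : ℝ)) := by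
        have : (periodIso τ hτ).symm w = fun p ↦ (N p : ℝ) := funext hN
        rw [← this, ContinuousLinearEquiv.apply_symm_apply]
      intro a
      rw [mem_lattice_cubePeriodPair_iff]
      refine ⟨N (a, 0), N (a, 1), ?_⟩
      conv_rhs => rw [hw]
      rw [periodIso_apply]
      push_cast
      ring
    · intro h
      choose M N hMN using fun a ↦ (mem_lattice_cubePeriodPair_iff τ hτ (w a)).mp (h a)
      have hw : w = periodIso τ hτ (fun p ↦ if p.2 = 0 then (M p.1 : ℝ) else (N p.1 : ℝ)) := by
        funext a
        rw [periodIso_apply, ← hMN a]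
        simp only [Fin.isValue, ↓reduceIte, one_ne_zero]
        push_cast
        ring
      funext p
      rw [ComplexTorus.cover_apply, ComplexTorus.cover_apply, ComplexTorus.proj_apply,
        ComplexTorus.proj_apply, hw, ContinuousLinearEquiv.symm_apply_apply, map_zero, Pi.zero_apply,
        QuotientAddGroup.mk_zero, AddCircle.coe_eq_zero_iff]
      split_ifs
      · exact ⟨M p.1, by rw [zsmul_eq_mul, mul_one]⟩
      · exact ⟨N p.1, by rw [zsmul_eq_mul, mul_one]⟩
  -- reduce to `z' = 0` by translation
  have hsub : ComplexTorus.cover (periodIso τ hτ) z = ComplexTorus.cover (periodIso τ hτ) z' ↔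
      ComplexTorus.cover (periodIso τ hτ) (z - z') = ComplexTorus.cover (periodIso τ hτ) 0 := by
    simp only [ComplexTorus.cover_apply, map_sub, map_zero]
    constructor
    · intro h
      funext p
      have hp := congrFun h p
      simp only [ComplexTorus.proj_apply, Pi.sub_apply, Pi.zero_apply] at hp ⊢
      rw [AddCircle.coe_sub, hp, sub_self, QuotientAddGroup.mk_zero]
    · intro h
      funext p
      have hp := congrFun h p
      simp only [ComplexTorus.proj_apply, Pi.sub_apply, Pi.zero_apply, QuotientAddGroup.mk_zero,
        AddCircle.coe_sub, sub_eq_zero] at hp ⊢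
      exact hp
  rw [hsub, key]
  simp only [Pi.sub_apply]

/-- **The comparison map `T_τ → (E × E × E)(ℂ)`**: `cubeMap` on the standard lift of a point of the
torus (well defined by `Λ³`-periodicity, `torusMap_cover`). In print: `(φ, φ, φ) : (ℂ/Λ)³ ≅ E(ℂ)³`,
Silverman VI.3.6 (b), and `(E³)^an = (E^an)³`, Serre GAGA §2. [cite: SilvermanAEC2009, VI Prop. 3.6 (b)] -/
def torusMap (t : EllipticCurveCubedTorus τ hτ) : ComplexPoints (cubeScheme τ hτ) :=
  cubeMap τ hτ (periodIso τ hτ (ComplexTorus.lift (periodIso τ hτ) t))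

/-- **`torusMap ∘ π = cubeMap`** for the covering map `π = cover : ℂ³ → T_τ`. [folklore] -/
theorem torusMap_cover (z : Fin 3 → ℂ) :
    torusMap τ hτ (ComplexTorus.cover (periodIso τ hτ) z) = cubeMap τ hτ z := by
  apply (cubeMap_eq_cubeMap_iff τ hτ).mpr
  apply (cover_eq_cover_iff τ hτ _ _).mp
  rw [ComplexTorus.cover_apply, ContinuousLinearEquiv.symm_apply_apply, ComplexTorus.proj_lift]

/-- **`torusMap` is injective** (`cubeMap` is injective modulo `Λ³`). [cite: SilvermanAEC2009, VI Prop. 3.6 (b)] -/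
theorem torusMap_injective : Function.Injective (torusMap τ hτ) := by
  intro t t' h
  obtain ⟨z, rfl⟩ := ComplexTorus.cover_surjective (periodIso τ hτ) t
  obtain ⟨z', rfl⟩ := ComplexTorus.cover_surjective (periodIso τ hτ) t'
  rw [torusMap_cover, torusMap_cover] at h
  exact (cover_eq_cover_iff τ hτ z z').mpr ((cubeMap_eq_cubeMap_iff τ hτ).mp h)

/-- **`torusMap` is surjective** (`cubeMap` is). [cite: SilvermanAEC2009, VI Prop. 3.6 (b)] -/
theorem torusMap_surjective : Function.Surjective (torusMap τ hτ) := by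
  intro Q
  obtain ⟨u, rfl⟩ := cubeMap_surjective τ hτ Q
  exact ⟨ComplexTorus.cover (periodIso τ hτ) u, torusMap_cover τ hτ u⟩

/-- Over the domain of a chart of the torus, `torusMap = cubeMap ∘ chart`. [folklore] -/
theorem cubeMap_chartAt {t s : EllipticCurveCubedTorus τ hτ} (hs : s ∈ (chartAt (Fin 3 → ℂ) t).source) :
    cubeMap τ hτ (chartAt (Fin 3 → ℂ) t s) = torusMap τ hτ s := by
  have hs' : ComplexTorus.cover (periodIso τ hτ) (chartAt (Fin 3 → ℂ) t s) = s := by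
    rw [ComplexTorus.chartAt_eq, ← ComplexTorus.chart_symm_eq_cover (periodIso τ hτ)
      (ComplexTorus.corner (periodIso τ hτ) t)]
    exact (ComplexTorus.chart (periodIso τ hτ) _).left_inv hs
  rw [← torusMap_cover, hs']

/-- **`torusMap` is continuous**: over each chart it is `cubeMap ∘ chart`. [folklore] -/
theorem continuous_torusMap : Continuous (torusMap τ hτ) := by
  refine continuous_iff_continuousAt.mpr fun t ↦ ?_
  have heq : (fun s ↦ cubeMap τ hτ (chartAt (Fin 3 → ℂ) t s)) =ᶠ[𝓝 t] torusMap τ hτ := by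
    filter_upwards [(chartAt (Fin 3 → ℂ) t).open_source.mem_nhds (mem_chart_source _ t)] with s hs
    exact cubeMap_chartAt τ hτ hs
  refine ContinuousAt.congr ?_ heq
  exact (continuous_cubeMap τ hτ).continuousAt.comp
    ((chartAt (Fin 3 → ℂ) t).continuousAt (mem_chart_source _ t))

/-- **`torusMap : T_τ → (E × E × E)(ℂ)` is a homeomorphism** (a continuous bijection from a compact
space onto a Hausdorff one; `(E³)(ℂ)` is Hausdorff as `E³` is separated). Silverman VI.3.6 (b) with
Serre GAGA §2 Prop. 6. [cite: SilvermanAEC2009, VI Prop. 3.6 (b)] -/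
theorem isHomeomorph_torusMap : IsHomeomorph (torusMap τ hτ) := by
  haveI : IsProper (cubeScheme τ hτ).hom :=
    IsSmoothProjective.isProper_holds (isSmoothProjective_cubeScheme τ hτ)
  haveI : T2Space (ComplexPoints (cubeScheme τ hτ)) := ComplexPoints.t2Space_of_isSeparated _
  exact isHomeomorph_iff_continuous_bijective.mpr
    ⟨continuous_torusMap τ hτ, torusMap_injective τ hτ, torusMap_surjective τ hτ⟩

/-- **`T_τ = ℂ³/(ℤ + τℤ)³` is the analytification of `E × E × E`**: `torusMap` is a homeomorphism
onto `(E³)(ℂ)`, the model `ℂ³` has dimension `3`, and regular functions on affine opens pull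
back to holomorphic functions on the complex torus (in the charts of `T_τ` they are the
holomorphic functions `g ∘ cubeMap` on `ℂ³`). This is Silverman, *AEC* VI Prop. 3.6 (b)
("`φ` is a complex analytic isomorphism") for each factor together with Serre, GAGA §2
(`(X × Y)^h = X^h × Y^h`), in the language of
`Literature.NumberTheory.Transcendental.IsAnalytification`.
[cite: SilvermanAEC2009, VI Prop. 3.6 (b)] [cite: SerreGAGA1956, §2 n°5] -/
theorem isAnalytification_torusMap :
    IsAnalytification (Fin 3 → ℂ) (cubeScheme τ hτ) 3 (torusMap τ hτ) where
  isHomeomorph := isHomeomorph_torusMap τ hτ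
  finrank_eq := by simp
  mdifferentiableOn_evalOrZero U s := by
    intro t ht
    refine MDifferentiableAt.mdifferentiableWithinAt ?_
    rw [mdifferentiableAt_iff]
    refine ⟨?_, ?_⟩
    · exact ((continuousOn_evalOrZero _ s).continuousAt ((isOpen_setOf_pt_mem _).mem_nhds ht)).comp
        (continuous_torusMap τ hτ).continuousAt
    · have hw : writtenInExtChartAt 𝓘(ℂ, Fin 3 → ℂ) 𝓘(ℂ, ℂ) t
          (fun m ↦ evalOrZero (↑U) s (torusMap τ hτ m)) =
          fun z ↦ evalOrZero (↑U) s (cubeMap τ hτ z) := by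
        funext z
        simp only [writtenInExtChartAt, extChartAt_model_space_eq_id, PartialEquiv.refl_coe,
          Function.comp_apply, id_eq]
        rw [ComplexTorus.extChartAt_symm_eq_cover, torusMap_cover]
      rw [hw]
      refine DifferentiableAt.differentiableWithinAt ?_
      have hz : cubeMap τ hτ (extChartAt 𝓘(ℂ, Fin 3 → ℂ) t t) = torusMap τ hτ t := by
        rw [← torusMap_cover, ComplexTorus.cover_extChartAt_self]
      refine (differentiableOn_evalOrZero_cubeMap τ hτ U s).differentiableAt
        ((isOpen_preimage_cubeMap τ hτ U).mem_nhds ?_)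
      change (cubeMap τ hτ (extChartAt 𝓘(ℂ, Fin 3 → ℂ) t t)).pt ∈ (↑U : (cubeScheme τ hτ).left.Opens)
      rw [hz]
      exact ht

end Cube

/-! ### Hypothesis (b) of `…_of_models`, and the named fact from de Rham's theorem -/

/-- **Algebraic models of the tori `ℂ³/(ℤ + τℤ)³`**: for every `τ` with `Im τ > 0` there is a
smooth projective complex threefold — `E_τ × E_τ × E_τ`, `E_τ` the Weierstrass cubic of the
lattice `ℤ + τℤ` — together with a map from the complex torus `T_τ` exhibiting it as the
analytification. Hypothesis (b) of `Grothendieck1969_ellipticCurveCubed_hodgeDecomposition_of_models`,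
verbatim. [cite: SilvermanAEC2009, VI Prop. 3.6 (b)] [cite: SerreGAGA1956, §2 n°5] -/
theorem exists_algebraicModel_ellipticCurveCubedTorus (τ : ℂ) (hτ : 0 < τ.im) :
    ∃ (X : Literature.AlgebraicGeometry.Motives.SchemeOver ℂ)
      (_ : Literature.AlgebraicGeometry.Motives.IsSmoothProjective 3 X)
      (φ : EllipticCurveCubedTorus τ hτ.ne' → Literature.AlgebraicGeometry.Motives.ComplexPoints X),
      IsAnalytification (Fin 3 → ℂ) X 3 φ :=
  ⟨cubeScheme τ hτ.ne', isSmoothProjective_cubeScheme τ hτ.ne', torusMap τ hτ.ne',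
    isAnalytification_torusMap τ hτ.ne'⟩

/-- **`Grothendieck1969_ellipticCurveCubed_hodgeDecomposition` follows from de Rham's theorem.**
The vendored Hodge structure of `H³(E_τ³)` in the Künneth basis (Lange–Birkenhake 1992,
§1.1.3–§1.1.5; the named fact of `…FiltOne.lean`) holds as soon as de Rham's theorem with complex
coefficients does for manifolds charted on `ℂ³` — the tree's named fact
`Literature.NumberTheory.Transcendental.exists_complexDeRhamIsoFamily (Fin 3 → ℂ)` (Wells, Thm. III.4.13):
everything else (the algebraic model `E_τ³` of `ℂ³/(ℤ + τℤ)³`, the rational structure, `b₃ = 20`,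
the Hodge pieces) is proved in the tree (`…_of_models`, `exists_algebraicModel_ellipticCurveCubedTorus`).
[cite: LangeBirkenhake1992, §1.1.3 Lemma 1.1.17, §1.1.4 Prop. 1.1.20, §1.1.5 Thm. 1.1.21 and Prop. 1.1.23]
[cite: SilvermanAEC2009, VI Prop. 3.6] [cite: SerreGAGA1956, §2 n°5] [cite: WellsDACM1980, Thm. III.4.13]
[cite: GrothendieckTopology1969, p. 300] -/
theorem Grothendieck1969_ellipticCurveCubed_hodgeDecomposition_of_deRham
    (hdR : exists_complexDeRhamIsoFamily (Fin 3 → ℂ)) :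
    Grothendieck1969_ellipticCurveCubed_hodgeDecomposition :=
  Grothendieck1969_ellipticCurveCubed_hodgeDecomposition_of_models hdR
    exists_algebraicModel_ellipticCurveCubedTorus

/-- **… and hence from the REAL de Rham theorem** `exists_deRhamIsoFamily 𝓘(ℝ, ℂ³)` (Warner,
Thm. 5.36; the tree's root named fact of `Transcendental/DeRhamTheorem.lean`), through the tree's
proved complexification `exists_complexDeRhamIsoFamily_of_exists_deRhamIsoFamily`
(`HodgeTheory/ComplexifiedDeRhamFamily.lean`). [cite: LangeBirkenhake1992, §1.1.5 Thm. 1.1.21 and Prop. 1.1.23]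
[cite: WarnerGTM94, Thm. 5.36 / Thm. 5.45] -/
theorem Grothendieck1969_ellipticCurveCubed_hodgeDecomposition_of_deRhamReal
    (hdR : exists_deRhamIsoFamily 𝓘(ℝ, Fin 3 → ℂ)) :
    Grothendieck1969_ellipticCurveCubed_hodgeDecomposition :=
  Grothendieck1969_ellipticCurveCubed_hodgeDecomposition_of_deRham
    (Literature.AlgebraicGeometry.HodgeTheory.exists_complexDeRhamIsoFamily_of_exists_deRhamIsoFamily hdR)

end Literature.Barriers.HodgeConjecture
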